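import Summits.BirchSwinnertonDyer.BirchSwinnertonDyer.Theorems.SchneiderFreeAdditiveX3UpperPotMultReadHyps
import HarnessLib
import HarnessLib.Audit.Tags

/-!
# Route `SchneiderFreeAdditiveX3` (K1 door), SECOND WING on the (M) cell — the co-socket's research input
# RESTRICTED TO THE CO-CRUX'S OWN HYPOTHESES: `PotMultRead.KYCHMUnitOrientedX3`

Cell `bsd-schneider-ideate` (HOME `run/shared/lean/pub/bsd-schneider-ideate/`), seat `door-c5` gen 12.
PARTITION: board row B6 ∩ X3 ∩ sst-twist, `r = 1`, (M) half (X3 ∧ (M), 4 541 of 7 101 pairs) of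
`Rank1Residual.partition`; types-the-object-of the ONE research input of the (M) CO-socket record
(`Upper.additiveIMCUpperBDPInputManinAt_potMult_of_facts_of_KYCHMUnitOriented`, this seat gen 10; sibling-route
crux r4 `PotMultBranchCoIMC` of planner P2 gen 13's package `memos/route-P2-upper/`) in EXACTLY the scope the
co-crux has; closes nothing (BSD is not advanced; no rung leaf registered). Theses-free. The upward twin of door-c2
gen 10's `PotMultRead.KYCHMOrientedX3` (`…PotMultReadHypsOrientedX3.lean`).

WHY. `PotMultRead.KYCHMUnitOriented` (this seat gen 10, `…UpperPotMultReadHyps.lean`) copies the quantification of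
door-c2's `KYCHMOriented`: EVERY globally minimal partner `V` multiplicative at `p` and every presentation
`W = C₂ • ((D • V) ⊗ χ_{p*})` of analytic rank one on the N10 locus — the whole potentially multiplicative additive
cell, `X3` (reducible `E[p]`) and `X4` (irreducible) alike, and every Heegner field of the socket. The co-crux it
serves — the class-level co-socket `∀ (W, p), p ≠ 2 → ClassX3 W p → SubM W p → Upper.AdditiveIMCUpperBDPInputManinAt W p`
— is stated (i) on `ClassX3 W p = Red W p ∧ Addv W p` only (door-c2 gen 10's observation for the lower stub, ask
«@door-c5: add `Red W p`»), and (ii) its socket `Upper.AdditiveIMCUpperBDPInputManinAt` carries the Kolyvagin-side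
binder `E(K)[p] = 0` (`∀ Q, p • Q = 0 → Q = 0`; `SchneiderFreeUpperSockets.lean` §2) which the lower socket does not
have and which `KYCHMUnitOriented` therefore lacks. `KYCHMUnitOrientedX3` inserts exactly these TWO binders —
the co-crux's own hypotheses, nothing else — so that (this seat gen 12, `…PotMultBranchCoIMCTight.lean`) the co-stub
becomes EQUIVALENT to the class-level co-socket modulo the route's named facts: the (M) co-line is then lossless,
and what a future theorem must supply upward is precisely the co-crux moved to the partner's side. The change is a
WEAKENING of the co-stub (`KYCHMUnitOriented → KYCHMUnitOrientedX3`, immediate by dropping two hypotheses; not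
stated as a theorem so that no audit reads a conjecture-to-conjecture implication as a proof).

Statement only — one predicate WITH BODY (conjecture-tagged obligation node, nothing asserted).
References: Keller–Yin arXiv:2410.23241 §3.4–3.5, p. 15 (shape; preprint; names the multiplicative branch open);
Cai–Shu–Tian, ANT 8 (2014) Thm. 1.5; Castella–Hsieh, Math. Ann. 370 (2018) Thm. 5.7, Lemma 5.4 (shape of the value
formula at `p ∤ N`); Gross, LMS LNS 153 (1991) §3 (orientations); Jetchev–Skinner–Wan 2017 §7.4.1 (the Kolyvagin-side
bookkeeping and its `E(K)[p] = 0`); barrier `Literature.Barriers.BirchSwinnertonDyer.ReducibleAnticyclotomicAtBadP`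
(scope).
-/

noncomputable section

open scoped Classical

open WeierstrassCurve NumberField IsDedekindDomain Field
  Literature.NumberTheory.EllipticCurves
  Literature.NumberTheory.EllipticCurves.CaiShuTian2014
  Literature.NumberTheory.EllipticCurves.ModularForms
  Literature.NumberTheory.EllipticCurves.GreenbergSelmer
  Literature.NumberTheory.EllipticCurves.Rank1Residual
  Literature.NumberTheory.GaloisRepresentations
  Literature.NumberTheory.GaloisCohomology
  Summit.BirchSwinnertonDyer.Rank1Residual
  Summit.BirchSwinnertonDyer.Rank1Residual.X11b
  Summit.BirchSwinnertonDyer.Rank1Residual.X11b.AcSelmer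
  Summit.BirchSwinnertonDyer.Rank1Residual.X11b.Halves

-- D-0017 layout: summit = sub-problem, so `Summit.BirchSwinnertonDyer.BirchSwinnertonDyer.…` is the
-- mandated namespace (same option as the route's sockets files).
set_option linter.dupNamespace false
set_option autoImplicit false

namespace Summit.BirchSwinnertonDyer.BirchSwinnertonDyer.Theorems.SchneiderFree.PotMultRead

/-- **`KYCHMUnitOrientedX3` — the ONE frame-level input of the (M) CO-socket record, oriented, restricted to the
co-crux's class `X3` (`Red W p`) AND to its Heegner fields with `E(K)[p] = 0`.** `KYCHMUnitOriented` with the two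
extra binders `Red (C₂ • ((D • V) ⊗ χ_{p*})) p` (the door curve's residual representation is reducible — the
class-level co-socket is stated on `ClassX3 = Red ∧ Addv` only; `Addv` and `SubM` follow from `Mult V p` and the
presentation) and `∀ Q ∈ W(K), p • Q = 0 → Q = 0` (VERBATIM the Kolyvagin-side binder of
`Upper.AdditiveIMCUpperBDPInputManinAt`). At every presented socket datum of such a door curve on the (M) cell and
every anticyclotomic frame `(κ, γ, 𝔭)` with `𝔭 ∣ p` of degree one, for every parametrisation datum `DtV` of the
partner: a series `L ∈ R₀⟦T⟧` and a UNIT `u ∈ R₀ˣ` with (co-h3|M) `(L) ⊆ Ch_Λ(X_ac^∅(W_K))·R₀⟦T⟧` (the Kolyvagin /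
Euler-system half of the branch main conjecture for the multiplicative Eisenstein partner on the `χ_ε`-branch) and
(h2|M) `L(0) = u·(log_ω Q / c_V)²` at the descended `χ_ε`-twisted conductor-`p` Heegner point `Q ∈ W(K)` of every
ORIENTATION `β` (`4 N_V ∣ β² − d_K`), `K[p]`-point `y` over `y_β(p)` and genus datum `θ`, `s`. RESEARCH — neither
half of that branch main conjecture nor the conductor-`p` `p`-adic value formula at `p ∥ N_V` is in print (barrier
`ReducibleAnticyclotomicAtBadP`); EQUIVALENT to the class-level co-socket on `ClassX3 ∩ SubM` modulo the route's
named facts (this seat gen 12). A predicate, conjecture-tagged, nothing asserted.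
[cite: KellerYin2024b, §3.4–3.5 and p. 15 (arXiv:2410.23241) (shape; preprint; names the case open)]
[cite: CastellaHsieh2018, Thm. 5.7 and Lemma 5.4 (shape of the value formula at p ∤ N)]
[cite: GrossLMS1991, §3 (Heegner points of conductor n and their orientations)]
[cite: JetchevSkinnerWan2017, §7.4.1 (arXiv:1512.06894 p. 30) (Kolyvagin-side bookkeeping, E(K)[p] = 0)] -/
@[conjecture]
def KYCHMUnitOrientedX3 : Prop :=
  ∀ (p : ℕ) [Fact p.Prime] (V : WeierstrassCurve ℚ) [V.IsElliptic] [V.IsGloballyMinimal]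
      [NeZero (V.conductorNorm ℤ)] (D C₂ : VariableChange ℚ) [(D • V).IsCharNeTwoNF]
      [(C₂ • (D • V).quadraticTwist ((-1 : ℚ) ^ (p / 2) * p)).IsElliptic]
      [(C₂ • (D • V).quadraticTwist ((-1 : ℚ) ^ (p / 2) * p)).IsGloballyMinimal]
      (N : ℕ) [NeZero N] (K : Type) [Field K] [NumberField K]
      (Dt : ModularParametrizationData (C₂ • (D • V).quadraticTwist ((-1 : ℚ) ^ (p / 2) * p)) N)
      (H : HeegnerDatum N (NumberField.discr K)) (ι : K →+* ℂ)
      (P : ((C₂ • (D • V).quadraticTwist ((-1 : ℚ) ^ (p / 2) * p)).baseChange K).toAffine.Point),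
      (C₂ • (D • V).quadraticTwist ((-1 : ℚ) ^ (p / 2) * p)).analyticRank = 1 →
      Additive.N10.Locus (C₂ • (D • V).quadraticTwist ((-1 : ℚ) ^ (p / 2) * p)) p →
      (C₂ • (D • V).quadraticTwist ((-1 : ℚ) ^ (p / 2) * p)).conductorNorm ℤ = N →
      IsImaginaryQuadratic K → Odd (NumberField.discr K) → ¬ p ∣ Units.torsionOrder K →
      SatisfiesHeegnerHypothesis N K →
      ((C₂ • (D • V).quadraticTwist ((-1 : ℚ) ^ (p / 2) * p)).quadraticTwist
        (NumberField.discr K : ℚ)).entireLFunction 1 ≠ 0 →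
      WeierstrassCurve.Affine.Point.map ι.toRatAlgHom P = heegnerPointComplex Dt H →
      ¬ IsOfFinAddOrder P → p ≠ 2 → Mult V p →
      Red (C₂ • (D • V).quadraticTwist ((-1 : ℚ) ^ (p / 2) * p)) p →
      (∀ Q : ((C₂ • (D • V).quadraticTwist ((-1 : ℚ) ^ (p / 2) * p)).baseChange K).toAffine.Point,
        p • Q = 0 → Q = 0) →
      ∀ (κ : ZpExtension K p), κ.IsAnticyclotomic →
      ∀ (γ : Field.absoluteGaloisGroup K) [Fact (κ.IsTopGenerator γ)]
        (𝔭 : HeightOneSpectrum (𝓞 K)) (h𝔭 : ((p : ℕ) : 𝓞 K) ∈ 𝔭.asIdeal)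
        (he : 𝔭.asIdeal.ramificationIdx (𝓞 ℚ) = 1) (hf : 𝔭.asIdeal.inertiaDeg (𝓞 ℚ) = 1),
      ∀ [NumberField (ringClassField K ι p)]
        (DtV : ModularParametrizationData V (V.conductorNorm ℤ)),
      ∃ (L : UnrSeries p) (u : (unrIntegers p)ˣ),
        Ideal.span {L} ≤
          (XAc.charIdeal ((C₂ • (D • V).quadraticTwist ((-1 : ℚ) ^ (p / 2) * p)).baseChange K)
            p κ 𝔭 ∅ γ).map (PowerSeries.map (toUnr p)) ∧
        ∀ (β : ℤ), 4 * (V.conductorNorm ℤ : ℤ) ∣ β ^ 2 - NumberField.discr K →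
        ∀ (y : (V.baseChange (ringClassField K ι p : Type)).toAffine.Point),
          WeierstrassCurve.Affine.Point.map (ringClassField K ι p).subtype.toRatAlgHom y =
            heegnerPointComplexOfConductor DtV (NumberField.discr K) β p →
          ∀ (θ : ringClassField K ι p)
            (hθ2 : θ ^ 2 = algebraMap ℚ (ringClassField K ι p) ((-1 : ℚ) ^ (p / 2) * p))
            (hθ : θ ≠ 0) (s : ringClassGal ι p → ℤˣ),
          (∀ σ : ringClassGal ι p, σ.1 θ = ((s σ : ℤ) : ringClassField K ι p) * θ) →
          ∀ Q : ((C₂ • (D • V).quadraticTwist ((-1 : ℚ) ^ (p / 2) * p)).baseChange K).toAffine.Point,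
          Affine.Point.map (algebraMap K (ringClassField K ι p)).toRatAlgHom Q =
            VariableChange.pointEquivBaseChange ((D • V).quadraticTwist ((-1 : ℚ) ^ (p / 2) * p)) C₂
              (ringClassField K ι p)
              ((VariableChange.pointEquiv (((D • V).quadraticTwist
                  ((-1 : ℚ) ^ (p / 2) * p)).baseChange (ringClassField K ι p : Type))
                  (untwistAt hθ)).symm
                ((Affine.Point.congrEquiv (untwistAt_smul_eq (D • V) hθ2 hθ)).symm
                  (VariableChange.pointEquivBaseChange V D (ringClassField K ι p)
                    (∑ τ : ringClassGal ι p,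
                      (s τ : ℤ) • pointGalHom V (ringClassField K ι p : Type) τ.1 y)))) →
          L.HasValueAt 0 ((((u : unrIntegers p)) : ℂ_[p]) *
            (algebraMap ℚ_[p] ℂ_[p] (logOmega (C₂ • (D • V).quadraticTwist ((-1 : ℚ) ^ (p / 2) * p))
              p (embAt K p 𝔭 h𝔭 he hf) Q / (DtV.c : ℚ_[p]))) ^ 2)

-- `KYCHMUnitOriented → KYCHMUnitOrientedX3` is immediate (ignore the two extra binders); it is not stated as a
-- theorem here so that no audit reads a conjecture-to-conjecture implication as a proof of `KYCHMUnitOrientedX3`.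

end Summit.BirchSwinnertonDyer.BirchSwinnertonDyer.Theorems.SchneiderFree.PotMultRead

end
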